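import Literature.NumberTheory.Sieve.ParityWave0
import Literature.NumberTheory.LFunctions.LiouvilleSumClassicalBound
import HarnessLib

/-!
# Parity wave 0, S22 — the odd-order logarithmic Chowla fact: source check, the partial-summation
# transfer, and the case `k = 1`

`Literature.NumberTheory.Sieve.liouville_logCorrelation_isLittleO_of_odd` (**parity.S22**,
`ParityWave0.lean`) is the named fact: for odd `k` and any shifts `h : Fin k → ℕ`,
`∑_{1 ≤ n ≤ x} λ(n + h₁) ⋯ λ(n + h_k) / n = o(log x)` along `x : ℕ`.

## Source check

The statement is Tao–Teräväinen, *Odd order cases of the logarithmically averaged Chowla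
conjecture*, J. Théor. Nombres Bordeaux 30 (2018), no. 3, 997–1015 (arXiv:1710.02112),
**Theorem 1.1**: "Let `k ≥ 1` be an odd natural number, and let `a₁, …, a_k, b₁, …, b_k` be natural
numbers. Then `(1/log x) ∑_{n ≤ x} λ(a₁ n + b₁) ⋯ λ(a_k n + b_k)/n = o_{x → ∞}(1)`", with Remark 1.2:
"as we are dealing with an odd number of shifts of the Liouville function, there is no need to
impose any non-degeneracy assumptions" — the vendored fact is the case `aᵢ = 1`, `bᵢ = hᵢ ∈ ℕ`
(shifts not necessarily distinct), i.e. FAITHFUL. The same statement is Theorem 1.1 (i) /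
Corollary 1.8 of Tao–Teräväinen, Duke Math. J. 168 (2019), 1977–2027 (arXiv:1708.02610; "any
integers `h₀, …, h_k` (not necessarily distinct)"). The docstring of the fact carries the interim key
`arXiv210306853` (= Helfgott–Radziwiłł, arXiv:2103.06853, whose quantitative two-point bound the
docstring itself says "is not stated here"): that key is a mechanical mis-attribution, the correct
cite is `[cite: TaoTeravainenJTNB2018, Theorem 1.1]` (locators "Thm 1.2" / "Cor. 1.5" in the
docstring are slips for Thm 1.1 / Thm 1.1 (i) and Cor. 1.8, arXiv numbering).

## Size of the printed proof (why there is no `_holds` here)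

JTNB §3 reduces Theorem 1.1 to two sub-theorems about `f_x(a) = 𝔼^{log}_{n ≤ x} ∏ λ(aᵢ n + a bᵢ)`:
Theorem 3.1, the approximate functional equation `𝔼_{2^m < p ≤ 2^{m+1}} |f_x(ap) − (−1)^k f_x(a)| ≪ ε`
off an exceptional set of scales (the entropy decrement argument of Tao, Forum Math. Pi 4 (2016),
in the strengthened form of the Duke paper), and Theorem 3.2, the comparison of prime and
almost-prime averages of `f_x`, whose proof is the Gowers uniformity of the `W`-tricked von Mangoldt
function (Green–Tao, Green–Tao–Ziegler inverse theorem); for odd `k` the two signs `f(1) = −𝔼_p f(p)`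
and `f(1) = +𝔼_{p₁} 𝔼_{p₂} f(p₁ p₂)` are then played against each other with a Turán–Kubilius
variance bound. None of these inputs is in the tree; every case `k ≥ 3` is a research-level
formalisation and is NOT attempted here.

## What is proved here

* `LogChowla.abel_sum_Icc_div` — Abel summation
  `∑_{n ≤ x} a(n)/n = T(x)/x + ∑_{1 ≤ n < x} T(n) (1/n − 1/(n+1))`, `T(n) = ∑_{1 ≤ m ≤ n} a(m)`;
* `isLittleO_log_sum_div_of_isLittleO_sum` — **the partial-summation transfer**: `T(x) = o(x)`
  implies `∑_{n ≤ x} a(n)/n = o(log x)` (JTNB §1: the Chowla estimate "implies [the logarithmically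
  averaged one] by partial summation"), and its `∑_{n < x}` variant;
* `liouville_logCorrelation_isLittleO_of_oddOrderChowla` — for every `k`, the un-averaged
  statement `OddOrderChowla k` (`ParityWave0.lean`) implies the logarithmically averaged one;
* `oddOrderChowla_one` — `OddOrderChowla 1`, i.e. `∑_{n < x} λ(n + h) = o(x)`, from the tree's
  PROVED prime number theorem for `λ`
  (`Literature.NumberTheory.LFunctions.abs_sum_liouville_le_logPow`: `|∑_{n ≤ x} λ(n)| ≤ C x/log x`);
* `liouville_logCorrelation_isLittleO_one` — the case `k = 1` of the fact
  (JTNB §1: the case `k = 1` "is equivalent to the prime number theorem … by an elementary argument");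
* `oddOrderChowla_of_chowlaConjecture`, `liouville_logCorrelation_isLittleO_of_odd_of_chowlaConjecture`
  — consistency with Chowla's conjecture (`ChowlaConjecture`, parity.S06, distinct shifts): for odd
  `k`, repeated shifts collapse to the odd, nonempty set of values taken an odd number of times
  (`LogChowla.prod_liouville_add_eq_prod_filter`, `LogChowla.odd_card_filter_odd`; JTNB §1, Remark
  1.2: "the non-degeneracy condition may be omitted when `k` is odd"), so `ChowlaConjecture` implies
  `OddOrderChowla k` and hence the fact. (A certificate that the vendored statement, with its edge
  conventions `λ(0) = 0`, `n ≥ 1`, non-distinct shifts, is implied by Chowla's conjecture; not a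
  proof of any open case.)

No new definitions, no new named facts.

## Normal form and the precise blocker (addendum)

* `liouville_logCorrelation_isLittleO_of_odd_iff_finset` — the fact is equivalent to its
  restriction to finite SETS of shifts of odd cardinality (JTNB Remark 1.2 made formal);
  `liouville_logCorrelation_isLittleO_of_card_filter_odd_eq_one` — every tuple whose set of
  odd-multiplicity values is a singleton is covered by the case `k = 1`;
  `liouville_logCorrelation_isLittleO_of_odd_of_three_le` — so the open content is exactly the case
  of `2j + 1 ≥ 3` distinct shifts.
* For that case the printed proof (JTNB §§3–5) needs, besides the entropy-decrement Theorem 3.1 and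
  the generalised von Neumann Lemma 5.2 (both provable from the tree's toolkit:
  `Literature/Probability/Entropy/FiniteShannon.lean`, `EntropyDecoupling.lean`,
  `Literature/NumberTheory/LFunctions/TaoHoeffding.lean`, `TaoEntropyDecrement.lean`, and the Gowers-norm
  files `LinearEquationsInPrimesGowersCauchySchwarz.lean`, `…Transference.lean`), the Gowers uniformity of
  the `W`-tricked von Mangoldt function at level `U^{k}` for `k` shifts (JTNB Lemma 5.3 and Remark 1.4:
  `U^3` for `k = 3`). In the tree this is the NAMED FACT
  `Literature.NumberTheory.Sieve.GreenTao2010_gowersUniformity` (`LinearEquationsInPrimesTransference.lean`;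
  level slices `GreenTao2010_gowersUniformityAt s`, `U^{s+1}`), of which only the level `s = 1` is proved
  (`GreenTao2010_gowersUniformityAt_one`, the circle method); the levels `s = k - 1 ≥ 2` needed here are
  reduced to Green–Tao 2010 Props. 10.1–10.2 (`GreenTao2010_gowersUniformity_of_relativeInverse_of_orthogonality`)
  and not discharged. That fact is the upstream blocker of every case `k ≥ 3` of parity.S22 along the
  printed line.

## References

* T. Tao, J. Teräväinen, *Odd order cases of the logarithmically averaged Chowla conjecture*,
  J. Théor. Nombres Bordeaux 30 (2018), no. 3, 997–1015, doi:10.5802/jtnb.1062, arXiv:1710.02112: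
  §1 (1.1) ⇒ (1.2) by partial summation; Theorem 1.1; Remark 1.2; §3 Theorems 3.1, 3.2.
  [cite: TaoTeravainenJTNB2018]
* T. Tao, J. Teräväinen, *The structure of logarithmically averaged correlations of multiplicative
  functions, with applications to the Chowla and Elliott conjectures*, Duke Math. J. 168 (2019),
  1977–2027, arXiv:1708.02610: Theorem 1.1 (i), Corollary 1.8. [cite: TaoTeravainenDuke2019]
* H. L. Montgomery, R. C. Vaughan, *Multiplicative Number Theory I*, CUP 2007, §6.2.1
  Exercise 11 (b): `∑_{n ≤ x} λ(n) ≪ x exp(−c √log x)` (the tree's `abs_sum_liouville_le_logPow`).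
  [cite: MontgomeryVaughan2007]
-/

open Filter Asymptotics Finset

namespace Literature.NumberTheory.Sieve

/-! ### Partial summation: `o(x)` sums give `o(log x)` logarithmic sums -/

namespace LogChowla

/-- Abel summation for logarithmic sums: with `T(n) = ∑_{1 ≤ m ≤ n} a(m)`,
`∑_{1 ≤ n ≤ x} a(n)/n = T(x)/x + ∑_{1 ≤ n < x} T(n) (1/n − 1/(n+1))` (for `x = 0` both sides vanish,
`T(0)/0 = 0` by convention). [folklore] -/
theorem abel_sum_Icc_div (a : ℕ → ℝ) (x : ℕ) :
    ∑ n ∈ Icc 1 x, a n / n =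
      (∑ n ∈ Icc 1 x, a n) / x +
        ∑ n ∈ Ico 1 x, (∑ m ∈ Icc 1 n, a m) * (1 / (n : ℝ) - 1 / ((n : ℝ) + 1)) := by
  induction x with
  | zero => simp
  | succ x ih =>
    rw [Finset.sum_Icc_succ_top (by omega), ih, Finset.sum_Icc_succ_top (by omega)]
    rcases Nat.eq_zero_or_pos x with rfl | hx
    · simp
    · rw [Finset.sum_Ico_succ_top hx]
      have hx0 : (x : ℝ) ≠ 0 := by exact_mod_cast hx.ne'
      have hx1 : (x : ℝ) + 1 ≠ 0 := by positivity
      push_cast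
      field_simp
      ring

/-- `∑_{n < x} 1/(n+1) = H_x` (Mathlib's `harmonic`, cast to `ℝ`). [folklore] -/
theorem sum_range_one_div_add_one (x : ℕ) :
    ∑ n ∈ range x, 1 / ((n : ℝ) + 1) = (harmonic x : ℝ) := by
  induction x with
  | zero => simp
  | succ x ih =>
    rw [Finset.sum_range_succ, ih, harmonic_succ]
    push_cast
    ring

/-- `∑_{n < x+1} a(n) = a(0) + ∑_{1 ≤ n ≤ x} a(n)`. [folklore] -/
theorem sum_range_add_one_eq (a : ℕ → ℝ) (x : ℕ) :
    ∑ n ∈ range (x + 1), a n = a 0 + ∑ n ∈ Icc 1 x, a n := by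
  induction x with
  | zero => simp
  | succ x ih =>
    rw [Finset.sum_range_succ, ih, Finset.sum_Icc_succ_top (by omega)]
    ring

/-- `o(x)` is insensitive to passing from `∑_{n < x}` to `∑_{1 ≤ n ≤ x}` (index shift by one and the
constant `a(0)`). [folklore] -/
theorem isLittleO_sum_Icc_of_isLittleO_sum_range {a : ℕ → ℝ}
    (ha : (fun x : ℕ => ∑ n ∈ range x, a n) =o[atTop] fun x : ℕ => (x : ℝ)) :
    (fun x : ℕ => ∑ n ∈ Icc 1 x, a n) =o[atTop] fun x : ℕ => (x : ℝ) := by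
  -- `x + 1 = O(x)` along `ℕ`
  have hO : (fun x : ℕ => (((x + 1 : ℕ) : ℝ))) =O[atTop] fun x : ℕ => (x : ℝ) := by
    refine IsBigO.of_bound 2 ?_
    filter_upwards [eventually_ge_atTop 1] with x hx
    have hx' : (1 : ℝ) ≤ x := by exact_mod_cast hx
    rw [Real.norm_natCast, Real.norm_natCast]
    push_cast
    linarith
  -- the shifted sums `∑_{n < x+1} a(n)` are `o(x)`
  have hshift : (fun x : ℕ => ∑ n ∈ range (x + 1), a n) =o[atTop] fun x : ℕ => (x : ℝ) :=
    (ha.comp_tendsto (tendsto_add_atTop_nat 1)).trans_isBigO hO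
  -- constants are `o(x)`
  have hconst : (fun _ : ℕ => a 0) =o[atTop] fun x : ℕ => (x : ℝ) :=
    isLittleO_const_left.2 (Or.inr (tendsto_norm_atTop_atTop.comp tendsto_natCast_atTop_atTop))
  refine (hshift.sub hconst).congr' (Eventually.of_forall fun x => ?_) EventuallyEq.rfl
  simp only [sum_range_add_one_eq]
  ring

end LogChowla

/-- **Partial summation transfer** (`o(x)` Cesàro sums give `o(log x)` logarithmic sums): if
`T(x) = ∑_{1 ≤ n ≤ x} a(n) = o(x)` then `∑_{1 ≤ n ≤ x} a(n)/n = o(log x)`. This is the "elementary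
argument" / "partial summation" by which an un-averaged correlation estimate such as Chowla's
conjecture implies its logarithmically averaged form (Tao–Teräväinen, JTNB 30 (2018), §1: "(1.1)
implies (1.2) by partial summation"). Proof: Abel summation
(`LogChowla.abel_sum_Icc_div`) and `|T(n)| ≤ (ε/2) n` for `n ≥ N₀` give
`|∑ a(n)/n| ≤ ε/2 + K_{N₀} + (ε/2) H_x ≤ ε log x` for large `x`. No boundedness of `a` is needed.
[cite: TaoTeravainenJTNB2018, §1 (partial summation remark after (1.2))] -/
theorem isLittleO_log_sum_div_of_isLittleO_sum {a : ℕ → ℝ}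
    (ha : (fun x : ℕ => ∑ n ∈ Icc 1 x, a n) =o[atTop] fun x : ℕ => (x : ℝ)) :
    (fun x : ℕ => ∑ n ∈ Icc 1 x, a n / n) =o[atTop] fun x : ℕ => Real.log x := by
  refine isLittleO_iff.2 fun ε hε => ?_
  have hε2 : 0 < ε / 2 := by linarith
  obtain ⟨N₀, hN₀⟩ := eventually_atTop.1 (isLittleO_iff.1 ha hε2)
  -- notation: partial sums and the Abel weights
  set T : ℕ → ℝ := fun n => ∑ m ∈ Icc 1 n, a m with hT
  set w : ℕ → ℝ := fun n => 1 / (n : ℝ) - 1 / ((n : ℝ) + 1) with hw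
  set N₁ : ℕ := max N₀ 1 with hN₁
  set K : ℝ := ∑ n ∈ Ico 1 N₁, |T n * w n| with hK
  have hK0 : 0 ≤ K := Finset.sum_nonneg fun n _ => abs_nonneg _
  have hTle : ∀ n, N₀ ≤ n → |T n| ≤ ε / 2 * n := fun n hn => by
    have := hN₀ n hn
    rwa [Real.norm_eq_abs, Real.norm_natCast] at this
  have hlog : Tendsto (fun x : ℕ => Real.log (x : ℝ)) atTop atTop :=
    Real.tendsto_log_atTop.comp tendsto_natCast_atTop_atTop
  filter_upwards [eventually_ge_atTop N₁, hlog.eventually_ge_atTop ((K + ε) / (ε / 2))]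
    with x hxN₁ hxlog
  have hxN₀ : N₀ ≤ x := le_trans (le_max_left _ _) hxN₁
  have hx1 : 1 ≤ x := le_trans (le_max_right _ _) hxN₁
  have hx0 : (0 : ℝ) < x := by exact_mod_cast hx1
  have hlogx : 0 ≤ Real.log (x : ℝ) := Real.log_nonneg (by exact_mod_cast hx1)
  have hKε : K + ε ≤ ε / 2 * Real.log x := by
    rwa [div_le_iff₀' hε2] at hxlog
  -- the first Abel term
  have h1 : |T x / x| ≤ ε / 2 := by
    rw [abs_div, Nat.abs_cast, div_le_iff₀ hx0]
    exact hTle x hxN₀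
  -- pointwise bound on the tail of the second Abel term
  have hpt : ∀ n ∈ Ico N₁ x, |T n * w n| ≤ ε / 2 * (1 / ((n : ℝ) + 1)) := by
    intro n hn
    rw [Finset.mem_Ico] at hn
    have hn1 : 1 ≤ n := le_trans (le_max_right _ _) hn.1
    have hnN : N₀ ≤ n := le_trans (le_max_left _ _) hn.1
    have hn0 : (0 : ℝ) < n := by exact_mod_cast hn1
    have hn0' : (n : ℝ) ≠ 0 := hn0.ne'
    have hn1' : (n : ℝ) + 1 ≠ 0 := by positivity
    have hd : 0 ≤ w n := by
      simp only [hw, sub_nonneg]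
      exact one_div_le_one_div_of_le hn0 (by linarith)
    rw [abs_mul, abs_of_nonneg hd]
    calc |T n| * w n ≤ ε / 2 * n * w n := mul_le_mul_of_nonneg_right (hTle n hnN) hd
      _ = ε / 2 * (1 / ((n : ℝ) + 1)) := by
          simp only [hw]
          field_simp
          ring
  -- the harmonic tail
  have hharm : ∑ n ∈ Ico N₁ x, 1 / ((n : ℝ) + 1) ≤ 1 + Real.log x :=
    calc ∑ n ∈ Ico N₁ x, 1 / ((n : ℝ) + 1) ≤ ∑ n ∈ range x, 1 / ((n : ℝ) + 1) := by
          rw [Finset.range_eq_Ico]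
          exact Finset.sum_le_sum_of_subset_of_nonneg
            (Finset.Ico_subset_Ico (Nat.zero_le _) le_rfl) fun n _ _ => by positivity
      _ = (harmonic x : ℝ) := LogChowla.sum_range_one_div_add_one x
      _ ≤ 1 + Real.log x := harmonic_le_one_add_log x
  -- the second Abel term
  have h2 : |∑ n ∈ Ico 1 x, T n * w n| ≤ K + ε / 2 * (1 + Real.log x) := by
    rw [← Finset.sum_Ico_consecutive _ (le_max_right N₀ 1) hxN₁]
    calc |∑ n ∈ Ico 1 N₁, T n * w n + ∑ n ∈ Ico N₁ x, T n * w n|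
        ≤ |∑ n ∈ Ico 1 N₁, T n * w n| + |∑ n ∈ Ico N₁ x, T n * w n| := abs_add_le _ _
      _ ≤ K + ∑ n ∈ Ico N₁ x, |T n * w n| :=
          add_le_add (Finset.abs_sum_le_sum_abs _ _) (Finset.abs_sum_le_sum_abs _ _)
      _ ≤ K + ∑ n ∈ Ico N₁ x, ε / 2 * (1 / ((n : ℝ) + 1)) := by
          gcongr with n hn
          exact hpt n hn
      _ = K + ε / 2 * ∑ n ∈ Ico N₁ x, 1 / ((n : ℝ) + 1) := by rw [Finset.mul_sum]
      _ ≤ K + ε / 2 * (1 + Real.log x) := by gcongr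
  -- assemble
  rw [LogChowla.abel_sum_Icc_div, Real.norm_eq_abs, Real.norm_eq_abs, abs_of_nonneg hlogx]
  calc |T x / x + ∑ n ∈ Ico 1 x, T n * w n|
      ≤ |T x / x| + |∑ n ∈ Ico 1 x, T n * w n| := abs_add_le _ _
    _ ≤ ε / 2 + (K + ε / 2 * (1 + Real.log x)) := add_le_add h1 h2
    _ = (K + ε) + ε / 2 * Real.log x := by ring
    _ ≤ ε / 2 * Real.log x + ε / 2 * Real.log x := by linarith
    _ = ε * Real.log x := by ring

/-- The `∑_{n < x}` form of the transfer: if `∑_{n < x} a(n) = o(x)` (the shape of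
`liouvilleCorrelation` and `OddOrderChowla`) then `∑_{1 ≤ n ≤ x} a(n)/n = o(log x)` (the shape of the
logarithmically averaged facts of `ParityWave0.lean`).
[cite: TaoTeravainenJTNB2018, §1 (partial summation remark after (1.2))] -/
theorem isLittleO_log_sum_div_of_isLittleO_sum_range {a : ℕ → ℝ}
    (ha : (fun x : ℕ => ∑ n ∈ range x, a n) =o[atTop] fun x : ℕ => (x : ℝ)) :
    (fun x : ℕ => ∑ n ∈ Icc 1 x, a n / n) =o[atTop] fun x : ℕ => Real.log x :=
  isLittleO_log_sum_div_of_isLittleO_sum (LogChowla.isLittleO_sum_Icc_of_isLittleO_sum_range ha)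

/-- **Un-averaged ⇒ logarithmically averaged, for Liouville correlations of any order.** If
`∑_{n < x} λ(n + h₁) ⋯ λ(n + h_k) = o(x)` for all shift tuples of length `k` (`OddOrderChowla k`), then
`∑_{1 ≤ n ≤ x} λ(n + h₁) ⋯ λ(n + h_k)/n = o(log x)` for all of them — the instance for
`a(n) = ∏ λ(n + hᵢ)` of the partial-summation transfer (Tao–Teräväinen, JTNB 30 (2018), §1). In
particular the named fact `liouville_logCorrelation_isLittleO_of_odd` is, for each odd `k`, the
logarithmic shadow of the OPEN statement `OddOrderChowla k`; the converse transfer is not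
automatic (`Literature/Barriers/Parity/LogarithmicAveraging.lean`).
[cite: TaoTeravainenJTNB2018, §1 (partial summation remark after (1.2))] -/
theorem liouville_logCorrelation_isLittleO_of_oddOrderChowla {k : ℕ} (hk : OddOrderChowla k)
    (h : Fin k → ℕ) :
    (fun x : ℕ => ∑ n ∈ Icc 1 x, (∏ i, ArithmeticFunction.liouville (n + h i) : ℝ) / n)
      =o[atTop] fun x : ℕ => Real.log x := by
  have hx := hk h
  simp only [liouvilleCorrelation, Int.cast_sum, Int.cast_prod] at hx
  exact isLittleO_log_sum_div_of_isLittleO_sum_range hx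

/-! ### The case `k = 1`: the prime number theorem for `λ` -/

namespace LogChowla

/-- `∑_{n < N} λ(n) = L(N) − λ(N)` with `L(N) = ∑_{0 < n ≤ N} λ(n)` (because `λ(0) = 0`).
[folklore] -/
theorem sum_range_liouville_eq (N : ℕ) :
    ∑ n ∈ range N, (ArithmeticFunction.liouville n : ℝ) =
      ∑ n ∈ Ioc 0 N, (ArithmeticFunction.liouville n : ℝ) - ArithmeticFunction.liouville N := by
  induction N with
  | zero => simp
  | succ N ih =>
    rw [Finset.sum_range_succ, ih, Finset.sum_Ioc_succ_top (Nat.zero_le _)]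
    ring

/-- The shifted Liouville sum against the summatory function `L`:
`∑_{n < x} λ(n + h) = (L(h + x) − λ(h + x)) − (L(h) − λ(h))`. [folklore] -/
theorem sum_range_liouville_add_eq (h x : ℕ) :
    ∑ n ∈ range x, (ArithmeticFunction.liouville (n + h) : ℝ) =
      (∑ n ∈ Ioc 0 (h + x), (ArithmeticFunction.liouville n : ℝ) -
          ArithmeticFunction.liouville (h + x)) -
        (∑ n ∈ Ioc 0 h, (ArithmeticFunction.liouville n : ℝ) - ArithmeticFunction.liouville h) := by
  rw [← sum_range_liouville_eq, ← sum_range_liouville_eq, Finset.sum_range_add]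
  simp only [add_comm h, add_sub_cancel_left]

/-- **`∑_{n < x} λ(n + h) = o(x)`** for every fixed shift `h` — the prime number theorem for the
Liouville function, here from the tree's proved bound `|L(y)| ≤ C y/log y` (`y ≥ 2`,
`Literature.NumberTheory.LFunctions.abs_sum_liouville_le_logPow` with `A = 1`; Montgomery–Vaughan
§6.2.1 Exercise 11 (b)) and `sum_range_liouville_add_eq`:
`|∑_{n<x} λ(n+h)| ≤ C (x + h)/log(x + h) + h + 2 = o(x)`.
[cite: MontgomeryVaughan2007, §6.2.1 Exercise 11 (b)] -/
theorem isLittleO_sum_range_liouville_add (h : ℕ) :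
    (fun x : ℕ => ∑ n ∈ range x, (ArithmeticFunction.liouville (n + h) : ℝ)) =o[atTop]
      fun x : ℕ => (x : ℝ) := by
  obtain ⟨C, hC⟩ := Literature.NumberTheory.LFunctions.abs_sum_liouville_le_logPow 1
  -- `L` along the naturals
  have hL : ∀ N : ℕ, 2 ≤ N →
      |∑ n ∈ Ioc 0 N, (ArithmeticFunction.liouville n : ℝ)| ≤ C * N / Real.log N := by
    intro N hN
    have := hC N (by exact_mod_cast hN)
    rwa [Nat.floor_natCast, Real.rpow_one] at this
  have hC0 : 0 ≤ C := by
    -- at `N = 2`: `0 ≤ |L(2)| ≤ C · 2/log 2`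
    have h2 := hL 2 (le_refl 2)
    have hlog2 : 0 < Real.log (2 : ℕ) := by
      rw [Nat.cast_ofNat]; exact Real.log_pos one_lt_two
    have : 0 ≤ C * (2 : ℕ) / Real.log (2 : ℕ) := (abs_nonneg _).trans h2
    rw [div_nonneg_iff] at this
    rcases this with ⟨h, -⟩ | ⟨-, h⟩
    · have h2' : (0 : ℝ) < (2 : ℕ) := by norm_num
      nlinarith
    · exact absurd h (not_le.2 hlog2)
  refine isLittleO_iff.2 fun ε hε => ?_
  -- choose `x` large: `x ≥ h + 2`, `2C/log x ≤ ε/2`, `h + 2 ≤ (ε/2) x`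
  have hlog : Tendsto (fun x : ℕ => Real.log (x : ℝ)) atTop atTop :=
    Real.tendsto_log_atTop.comp tendsto_natCast_atTop_atTop
  have hlim1 : Tendsto (fun x : ℕ => 2 * C / Real.log (x : ℝ)) atTop (nhds 0) :=
    tendsto_const_nhds.div_atTop hlog
  have hlim2 : Tendsto (fun x : ℕ => ((h : ℝ) + 2) / (x : ℝ)) atTop (nhds 0) :=
    tendsto_const_nhds.div_atTop tendsto_natCast_atTop_atTop
  have hε2 : 0 < ε / 2 := by linarith
  filter_upwards [eventually_ge_atTop (h + 2), hlim1.eventually (ge_mem_nhds hε2),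
    hlim2.eventually (ge_mem_nhds hε2)] with x hxh hx1 hx2
  have hx2' : 2 ≤ x := le_trans (Nat.le_add_left 2 h) hxh
  have hx0 : (0 : ℝ) < x := by exact_mod_cast (lt_of_lt_of_le Nat.zero_lt_two hx2')
  have hxr : (2 : ℝ) ≤ x := by exact_mod_cast hx2'
  have hlogx : 0 < Real.log (x : ℝ) := Real.log_pos (by linarith)
  have hhx : 2 ≤ h + x := le_trans hx2' (Nat.le_add_left x h)
  have hhx0 : (0 : ℝ) < ((h + x : ℕ) : ℝ) := by exact_mod_cast (lt_of_lt_of_le Nat.zero_lt_two hhx)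
  have hloghx : Real.log (x : ℝ) ≤ Real.log ((h + x : ℕ) : ℝ) :=
    Real.log_le_log hx0 (by exact_mod_cast Nat.le_add_left x h)
  -- the main term `|L(h + x)| ≤ C (h+x)/log(h+x) ≤ 2 C x/log x`
  have hmain : |∑ n ∈ Ioc 0 (h + x), (ArithmeticFunction.liouville n : ℝ)| ≤
      2 * C / Real.log x * x := by
    have hhx2x : ((h + x : ℕ) : ℝ) ≤ 2 * x := by
      push_cast
      have : (h : ℝ) + 2 ≤ x := by exact_mod_cast hxh
      linarith
    calc |∑ n ∈ Ioc 0 (h + x), (ArithmeticFunction.liouville n : ℝ)|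
        ≤ C * ((h + x : ℕ) : ℝ) / Real.log ((h + x : ℕ) : ℝ) := hL (h + x) hhx
      _ ≤ C * (2 * x) / Real.log (x : ℝ) := by
          rw [div_le_div_iff₀ (lt_of_lt_of_le hlogx hloghx) hlogx]
          have h1 : C * ((h + x : ℕ) : ℝ) ≤ C * (2 * x) := mul_le_mul_of_nonneg_left hhx2x hC0
          have h2 : 0 ≤ C * ((h + x : ℕ) : ℝ) := mul_nonneg hC0 hhx0.le
          calc C * ((h + x : ℕ) : ℝ) * Real.log (x : ℝ)
              ≤ C * (2 * x) * Real.log (x : ℝ) := mul_le_mul_of_nonneg_right h1 hlogx.le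
            _ ≤ C * (2 * x) * Real.log ((h + x : ℕ) : ℝ) :=
                mul_le_mul_of_nonneg_left hloghx (by positivity)
      _ = 2 * C / Real.log x * x := by
          field_simp
  -- the three small terms
  have hsmall : |(ArithmeticFunction.liouville (h + x) : ℝ)| +
      |∑ n ∈ Ioc 0 h, (ArithmeticFunction.liouville n : ℝ) - ArithmeticFunction.liouville h| ≤
        (h : ℝ) + 2 := by
    have e1 := Literature.NumberTheory.LFunctions.LiouvilleSum.abs_liouville_le_one (h + x)
    have e2 := Literature.NumberTheory.LFunctions.LiouvilleSum.abs_sum_liouville_le h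
    have e3 := Literature.NumberTheory.LFunctions.LiouvilleSum.abs_liouville_le_one h
    calc |(ArithmeticFunction.liouville (h + x) : ℝ)| +
          |∑ n ∈ Ioc 0 h, (ArithmeticFunction.liouville n : ℝ) - ArithmeticFunction.liouville h|
        ≤ 1 + (|∑ n ∈ Ioc 0 h, (ArithmeticFunction.liouville n : ℝ)| +
            |(ArithmeticFunction.liouville h : ℝ)|) := add_le_add e1 (abs_sub _ _)
      _ ≤ 1 + ((h : ℝ) + 1) := by gcongr
      _ = (h : ℝ) + 2 := by ring
  -- assemble
  rw [Real.norm_eq_abs, Real.norm_natCast, sum_range_liouville_add_eq]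
  calc |(∑ n ∈ Ioc 0 (h + x), (ArithmeticFunction.liouville n : ℝ) -
          ArithmeticFunction.liouville (h + x)) -
        (∑ n ∈ Ioc 0 h, (ArithmeticFunction.liouville n : ℝ) - ArithmeticFunction.liouville h)|
      ≤ |∑ n ∈ Ioc 0 (h + x), (ArithmeticFunction.liouville n : ℝ) -
          ArithmeticFunction.liouville (h + x)| +
        |∑ n ∈ Ioc 0 h, (ArithmeticFunction.liouville n : ℝ) - ArithmeticFunction.liouville h| :=
        abs_sub _ _
    _ ≤ (|∑ n ∈ Ioc 0 (h + x), (ArithmeticFunction.liouville n : ℝ)| +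
          |(ArithmeticFunction.liouville (h + x) : ℝ)|) +
        |∑ n ∈ Ioc 0 h, (ArithmeticFunction.liouville n : ℝ) - ArithmeticFunction.liouville h| :=
        by gcongr; exact abs_sub _ _
    _ ≤ 2 * C / Real.log x * x + ((h : ℝ) + 2) := by linarith [hmain, hsmall]
    _ ≤ ε / 2 * x + ε / 2 * x := by
        have e2 : (h : ℝ) + 2 ≤ ε / 2 * x := by rwa [div_le_iff₀ hx0] at hx2
        have e1 : 2 * C / Real.log x * x ≤ ε / 2 * x := mul_le_mul_of_nonneg_right hx1 hx0.le
        linarith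
    _ = ε * x := by ring

end LogChowla

/-- **`OddOrderChowla 1` holds**: for every shift `h`, `∑_{n < x} λ(n + h) = o(x)` — the case `k = 1`
of Chowla's conjecture, which "is equivalent to the prime number theorem … by an elementary
argument" (Tao–Teräväinen, JTNB 30 (2018), §1); here from the tree's proved
`Literature.NumberTheory.LFunctions.abs_sum_liouville_le_logPow` (Montgomery–Vaughan §6.2.1
Exercise 11 (b)). The cases `k ≥ 3` of `OddOrderChowla k` are OPEN (see its docstring) and are not
touched. [cite: TaoTeravainenJTNB2018, §1 (the case k = 1 and the prime number theorem)] -/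
theorem oddOrderChowla_one : OddOrderChowla 1 := by
  intro h
  have := LogChowla.isLittleO_sum_range_liouville_add (h 0)
  refine this.congr' (Eventually.of_forall fun x => ?_) EventuallyEq.rfl
  simp [liouvilleCorrelation]

/-- **The case `k = 1` of parity.S22** (`liouville_logCorrelation_isLittleO_of_odd` restricted to
one shift): `∑_{1 ≤ n ≤ x} λ(n + h)/n = o(log x)`, from `oddOrderChowla_one` (prime number theorem for
`λ`) by the partial-summation transfer. Tao–Teräväinen, JTNB 30 (2018), Theorem 1.1 is the statement
for every odd `k`; only this first case is proved in the tree, the cases `k ≥ 3` (entropy decrement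
and Gowers uniformity of the von Mangoldt function, op. cit. §3) are not.
[cite: TaoTeravainenJTNB2018, Theorem 1.1 (case k = 1)] -/
theorem liouville_logCorrelation_isLittleO_one (h : Fin 1 → ℕ) :
    (fun x : ℕ => ∑ n ∈ Icc 1 x, (∏ i, ArithmeticFunction.liouville (n + h i) : ℝ) / n)
      =o[atTop] fun x : ℕ => Real.log x :=
  liouville_logCorrelation_isLittleO_of_oddOrderChowla oddOrderChowla_one h

/-! ### Consistency with Chowla's conjecture: repeated shifts collapse to an odd distinct set -/

namespace LogChowla

/-- `λ(m)^j = λ(m)` for odd `j` and `= 1` for even `j`, when `m ≠ 0` (`λ(m) = ±1`). [folklore] -/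
theorem liouville_pow_eq_ite {m : ℕ} (hm : m ≠ 0) (j : ℕ) :
    (ArithmeticFunction.liouville m : ℝ) ^ j =
      if Odd j then (ArithmeticFunction.liouville m : ℝ) else 1 := by
  rw [ArithmeticFunction.liouville_apply hm]
  push_cast
  rw [← pow_mul]
  rcases Nat.even_or_odd j with hj | hj
  · rw [if_neg (Nat.not_odd_iff_even.2 hj), Even.neg_one_pow (hj.mul_left _)]
  · rw [if_pos hj]
    rcases Nat.even_or_odd (ArithmeticFunction.cardFactors m) with hm' | hm'
    · rw [Even.neg_one_pow (hm'.mul_right _), Even.neg_one_pow hm']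
    · rw [Odd.neg_one_pow (hm'.mul hj), Odd.neg_one_pow hm']

/-- **Collapsing repeated shifts.** For `n ≠ 0` and any tuple of shifts `h : Fin k → ℕ`,
`∏ᵢ λ(n + hᵢ) = ∏_{v ∈ S(h)} λ(n + v)`, where `S(h)` is the set of values of `h` taken an odd
number of times (`λ(n + v)² = 1`; Tao–Teräväinen, JTNB 30 (2018), §1: "a degenerate pair … is
constant in `n` and can therefore be deleted"). [cite: TaoTeravainenJTNB2018, §1 (Remark 1.2 and the deletion of degenerate pairs)] -/
theorem prod_liouville_add_eq_prod_filter {k : ℕ} (h : Fin k → ℕ) {n : ℕ} (hn : n ≠ 0) :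
    ∏ i, (ArithmeticFunction.liouville (n + h i) : ℝ) =
      ∏ v ∈ (univ.image h).filter (fun v => Odd #(univ.filter fun i => h i = v)),
        (ArithmeticFunction.liouville (n + v) : ℝ) := by
  rw [Finset.prod_filter]
  calc ∏ i, (ArithmeticFunction.liouville (n + h i) : ℝ)
      = ∏ v ∈ univ.image h,
          (ArithmeticFunction.liouville (n + v) : ℝ) ^ #(univ.filter fun i => h i = v) :=
        Finset.prod_comp (fun v => (ArithmeticFunction.liouville (n + v) : ℝ)) h
    _ = ∏ v ∈ univ.image h, if Odd #(univ.filter fun i => h i = v) then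
          (ArithmeticFunction.liouville (n + v) : ℝ) else 1 :=
        Finset.prod_congr rfl fun v _ => liouville_pow_eq_ite (by omega) _

/-- For odd `k`, the set `S(h)` of values of `h : Fin k → ℕ` taken an odd number of times has odd
(in particular nonzero) cardinality: `k = ∑_{v} #h⁻¹(v)` and a sum of naturals is odd iff an odd
number of its terms are odd. [folklore] -/
theorem odd_card_filter_odd {k : ℕ} (hk : Odd k) (h : Fin k → ℕ) :
    Odd #((univ.image h).filter fun v => Odd #(univ.filter fun i => h i = v)) := by
  have hcard : ∑ v ∈ univ.image h, #(univ.filter fun i => h i = v) = k := by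
    rw [← Finset.card_eq_sum_card_image h univ, Finset.card_univ, Fintype.card_fin]
  refine (Finset.odd_sum_iff_odd_card_odd fun v => #(univ.filter fun i => h i = v)).1 ?_
  rw [hcard]
  exact hk

/-- `|∏ λ(f i)| ≤ 1` for any finite product of Liouville values. [folklore] -/
theorem abs_prod_liouville_le_one {ι : Type*} (s : Finset ι) (f : ι → ℕ) :
    |∏ i ∈ s, (ArithmeticFunction.liouville (f i) : ℝ)| ≤ 1 := by
  rw [Finset.abs_prod]
  exact Finset.prod_le_one (fun i _ => abs_nonneg _)
    fun i _ => Literature.NumberTheory.LFunctions.LiouvilleSum.abs_liouville_le_one (f i)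

end LogChowla

/-- **Chowla's conjecture implies `OddOrderChowla k` for every odd `k`** (repeated shifts
allowed): collapse the repeated shifts to the odd, nonempty set `S(h)` of values taken an odd
number of times (`LogChowla.prod_liouville_add_eq_prod_filter`, `LogChowla.odd_card_filter_odd`),
enumerate `S(h)` injectively (`Finset.orderEmbOfFin`) and apply `ChowlaConjecture` to that tuple;
the two correlation sums `∑_{n < x}` then agree except for the single term `n = 0` (where `λ(0) = 0`
may intervene), which is `O(1) = o(x)`. This is the remark of Tao–Teräväinen, JTNB 30 (2018), §1
that for an odd number of Liouville factors "the non-degeneracy condition may be omitted". It does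
NOT prove any case of `OddOrderChowla` (Chowla's conjecture is open); it certifies that the
un-averaged odd-order statements are consequences of `ChowlaConjecture` as vendored.
[cite: TaoTeravainenJTNB2018, §1 (Remark 1.2 and the deletion of degenerate pairs)] -/
theorem oddOrderChowla_of_chowlaConjecture (hC : ChowlaConjecture) {k : ℕ} (hk : Odd k) :
    OddOrderChowla k := by
  intro h
  set S : Finset ℕ := (univ.image h).filter fun v => Odd #(univ.filter fun i => h i = v) with hS
  have hSodd : Odd S.card := LogChowla.odd_card_filter_odd hk h
  -- an injective enumeration `g : Fin m ↪ ℕ` of `S`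
  obtain ⟨m, g, hgS⟩ : ∃ (m : ℕ) (g : Fin m ↪ ℕ), (univ : Finset (Fin m)).map g = S :=
    ⟨S.card, (S.orderEmbOfFin rfl).toEmbedding, Finset.map_orderEmbOfFin_univ S rfl⟩
  have hm : 0 < m := by
    have : S.card = m := by rw [← hgS, Finset.card_map, Finset.card_univ, Fintype.card_fin]
    rw [← this]
    exact hSodd.pos
  have hCg := hC m g hm g.injective
  -- the two products agree for `n ≠ 0`
  have hprod : ∀ n : ℕ, n ≠ 0 →
      ∏ i, (ArithmeticFunction.liouville (n + h i) : ℝ) =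
        ∏ j, (ArithmeticFunction.liouville (n + g j) : ℝ) := by
    intro n hn
    rw [LogChowla.prod_liouville_add_eq_prod_filter h hn, ← hS, ← hgS, Finset.prod_map]
  -- hence the correlation sums differ only by the `n = 0` terms
  have hdiff : ∀ y : ℕ, (liouvilleCorrelation h (y + 1) : ℝ) - (liouvilleCorrelation g (y + 1) : ℝ) =
      (∏ i, (ArithmeticFunction.liouville (h i) : ℝ)) -
        ∏ j, (ArithmeticFunction.liouville (g j) : ℝ) := by
    intro y
    simp only [liouvilleCorrelation, Finset.sum_range_succ', zero_add]
    push_cast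
    rw [Finset.sum_congr rfl fun n _ => hprod (n + 1) (Nat.succ_ne_zero n)]
    ring
  have hO : (fun x : ℕ => (liouvilleCorrelation h x : ℝ) - liouvilleCorrelation g x) =o[atTop]
      fun x : ℕ => (x : ℝ) := by
    have hbd : (fun x : ℕ => (liouvilleCorrelation h x : ℝ) - liouvilleCorrelation g x) =O[atTop]
        fun _ : ℕ => (1 : ℝ) := by
      refine IsBigO.of_bound 2 ?_
      filter_upwards [eventually_ge_atTop 1] with x hx
      obtain ⟨y, rfl⟩ := Nat.exists_eq_add_one_of_ne_zero (by omega : x ≠ 0)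
      rw [hdiff, Real.norm_eq_abs, norm_one, mul_one]
      calc |(∏ i, (ArithmeticFunction.liouville (h i) : ℝ)) -
              ∏ j, (ArithmeticFunction.liouville (g j) : ℝ)|
          ≤ |∏ i, (ArithmeticFunction.liouville (h i) : ℝ)| +
              |∏ j, (ArithmeticFunction.liouville (g j) : ℝ)| := abs_sub _ _
        _ ≤ 1 + 1 := add_le_add (LogChowla.abs_prod_liouville_le_one _ _)
            (LogChowla.abs_prod_liouville_le_one _ _)
        _ = 2 := by norm_num
    exact hbd.trans_isLittleO
      (isLittleO_const_left.2
        (Or.inr (tendsto_norm_atTop_atTop.comp tendsto_natCast_atTop_atTop)))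
  have := hO.add hCg
  simpa only [sub_add_cancel] using this

/-- **Chowla's conjecture implies parity.S22** (the fact `liouville_logCorrelation_isLittleO_of_odd`,
all odd `k`, repeated shifts allowed): `oddOrderChowla_of_chowlaConjecture` followed by the
partial-summation transfer `liouville_logCorrelation_isLittleO_of_oddOrderChowla`. A consistency
certificate for the vendored statement (edge conventions `λ(0) = 0`, sums from `n = 1`,
non-distinct shifts); the fact itself is Tao–Teräväinen's unconditional Theorem 1.1, not proved
here. [cite: TaoTeravainenJTNB2018, Theorem 1.1 and §1] -/
theorem liouville_logCorrelation_isLittleO_of_odd_of_chowlaConjecture (hC : ChowlaConjecture) :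
    liouville_logCorrelation_isLittleO_of_odd := by
  intro k hk h
  exact liouville_logCorrelation_isLittleO_of_oddOrderChowla
    (oddOrderChowla_of_chowlaConjecture hC hk) h

/-! ### Normal form of the fact: finite sets of shifts of odd size (JTNB Remark 1.2) -/

/-- **Degenerate tuples of shifts.** If the set `S(h)` of values of `h : Fin k → ℕ` taken an odd
number of times is a singleton `{v}`, then `∑_{n ≤ x} λ(n + h₁) ⋯ λ(n + h_k) / n = o(log x)`: for
`n ≥ 1` the repeated shifts collapse (`LogChowla.prod_liouville_add_eq_prod_filter`) to the single
factor `λ(n + v)`, and the case `k = 1` (`liouville_logCorrelation_isLittleO_one`, the prime number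
theorem for `λ`) applies. For odd `k` the cardinality `#S(h)` is odd
(`LogChowla.odd_card_filter_odd`), so this is exactly the sub-case `#S(h) ≤ 1` of the fact
`liouville_logCorrelation_isLittleO_of_odd` (e.g. `λ(n + a) λ(n + a) λ(n + b)`); the first case not
proved in the tree is `#S(h) = 3`. (For `#S(h) = 0`, an even-`k` phenomenon, the product is `1` and
the sum is the harmonic sum `∼ log x`, so no such statement holds.) Tao–Teräväinen, JTNB 30 (2018),
§1: "a degenerate pair … is constant in `n` and can therefore be deleted".
[cite: TaoTeravainenJTNB2018, §1 (Remark 1.2 and the deletion of degenerate pairs)] -/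
theorem liouville_logCorrelation_isLittleO_of_card_filter_odd_eq_one {k : ℕ} (h : Fin k → ℕ)
    (hS : #((univ.image h).filter fun v => Odd #(univ.filter fun i => h i = v)) = 1) :
    (fun x : ℕ => ∑ n ∈ Icc 1 x, (∏ i, ArithmeticFunction.liouville (n + h i) : ℝ) / n)
      =o[atTop] fun x : ℕ => Real.log x := by
  obtain ⟨v, hv⟩ := Finset.card_eq_one.1 hS
  have hprod : ∀ n : ℕ, n ≠ 0 →
      ∏ i, (ArithmeticFunction.liouville (n + h i) : ℝ) =
        ArithmeticFunction.liouville (n + v) := by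
    intro n hn
    rw [LogChowla.prod_liouville_add_eq_prod_filter h hn, hv, Finset.prod_singleton]
  have h1 := liouville_logCorrelation_isLittleO_one fun _ : Fin 1 => v
  refine h1.congr' (Eventually.of_forall fun x => ?_) EventuallyEq.rfl
  refine Finset.sum_congr rfl fun n hn => ?_
  have hn0 : n ≠ 0 := by
    have := (Finset.mem_Icc.1 hn).1
    omega
  simp only [Fin.prod_univ_one, hprod n hn0]

/-- **Normal form of parity.S22** (Tao–Teräväinen's Remark 1.2 made formal). The fact
`liouville_logCorrelation_isLittleO_of_odd` (odd `k`, shifts `h : Fin k → ℕ` not necessarily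
distinct) is equivalent to its restriction to finite SETS of shifts of odd cardinality:
`∑_{n ≤ x} (∏_{v ∈ s} λ(n + v)) / n = o(log x)` for every `s : Finset ℕ` with `#s` odd. Forward: a
set `s` is the injective tuple `Fin #s ↪ ℕ` enumerating it increasingly (`Finset.orderEmbOfFin`);
backward: a tuple collapses, for `n ≥ 1`, to the set `S(h)` of its values of odd multiplicity
(`LogChowla.prod_liouville_add_eq_prod_filter`), which has odd cardinality for odd `k`
(`LogChowla.odd_card_filter_odd`). So the open content of the fact is exactly the case of `2j + 1`
DISTINCT shifts, `j ≥ 1`. [cite: TaoTeravainenJTNB2018, §1 (Remark 1.2 and the deletion of degenerate pairs)] -/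
theorem liouville_logCorrelation_isLittleO_of_odd_iff_finset :
    liouville_logCorrelation_isLittleO_of_odd ↔
      ∀ s : Finset ℕ, Odd #s →
        (fun x : ℕ => ∑ n ∈ Icc 1 x, (∏ v ∈ s, ArithmeticFunction.liouville (n + v) : ℝ) / n)
          =o[atTop] fun x : ℕ => Real.log x := by
  constructor
  · intro hF s hs
    have key := hF #s hs fun i => s.orderEmbOfFin rfl i
    refine key.congr' (Eventually.of_forall fun x => ?_) EventuallyEq.rfl
    refine Finset.sum_congr rfl fun n _ => ?_
    congr 1
    calc ∏ i, (ArithmeticFunction.liouville (n + s.orderEmbOfFin rfl i) : ℝ)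
        = ∏ v ∈ (univ : Finset (Fin #s)).map (s.orderEmbOfFin rfl).toEmbedding,
            (ArithmeticFunction.liouville (n + v) : ℝ) :=
          (Finset.prod_map univ (s.orderEmbOfFin rfl).toEmbedding
            fun v => (ArithmeticFunction.liouville (n + v) : ℝ)).symm
      _ = ∏ v ∈ s, (ArithmeticFunction.liouville (n + v) : ℝ) := by
          rw [Finset.map_orderEmbOfFin_univ s rfl]
  · intro hF k hk h
    have hs := hF _ (LogChowla.odd_card_filter_odd hk h)
    refine hs.congr' (Eventually.of_forall fun x => ?_) EventuallyEq.rfl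
    refine Finset.sum_congr rfl fun n hn => ?_
    have hn0 : n ≠ 0 := by
      have := (Finset.mem_Icc.1 hn).1
      omega
    rw [LogChowla.prod_liouville_add_eq_prod_filter h hn0]

/-- **The open content of parity.S22, isolated**: given the fact for SETS of `2j + 1` distinct
shifts with `j ≥ 1` (the cases `k = 3, 5, 7, …` of Tao–Teräväinen's Theorem 1.1 with distinct
`bᵢ`), the whole fact follows — singletons are the proved case `k = 1`
(`liouville_logCorrelation_isLittleO_one`). This is the precise residual statement that the
entropy-decrement argument and the `U^{k}`-uniformity of the `W`-tricked von Mangoldt function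
(op. cit. Theorems 3.1, 3.2; for `k` shifts Lemma 5.2 consumes `‖Λ_{b,W} - 1‖_{U^{k}}`, i.e. the
level `s = k - 1 ≥ 2` of the tree's named fact `GreenTao2010_gowersUniformity`, of which only the
level `s = 1` is proved in the tree, `GreenTao2010_gowersUniformityAt_one`) would have to supply.
[cite: TaoTeravainenJTNB2018, Theorem 1.1, Remark 1.4 and Lemma 5.3] -/
theorem liouville_logCorrelation_isLittleO_of_odd_of_three_le
    (H : ∀ s : Finset ℕ, Odd #s → 3 ≤ #s →
      (fun x : ℕ => ∑ n ∈ Icc 1 x, (∏ v ∈ s, ArithmeticFunction.liouville (n + v) : ℝ) / n)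
        =o[atTop] fun x : ℕ => Real.log x) :
    liouville_logCorrelation_isLittleO_of_odd := by
  refine liouville_logCorrelation_isLittleO_of_odd_iff_finset.2 fun s hs => ?_
  by_cases h3 : 3 ≤ #s
  · exact H s hs h3
  · -- `#s` odd and `< 3`, so `s = {v}`: the case `k = 1`
    have h1 : #s = 1 := by
      obtain ⟨j, hj⟩ := hs
      omega
    obtain ⟨v, rfl⟩ := Finset.card_eq_one.1 h1
    have h1' := liouville_logCorrelation_isLittleO_one fun _ : Fin 1 => v
    refine h1'.congr' (Eventually.of_forall fun x => ?_) EventuallyEq.rfl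
    refine Finset.sum_congr rfl fun n _ => ?_
    simp only [Fin.prod_univ_one, Finset.prod_singleton]

end Literature.NumberTheory.Sieve
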